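import Literature.NumberTheory.DiophantineGeometry.GenEllConjugateCompactness
import HarnessLib

/-!
# [GenEll] Thm. 2.1 (ii) ⇒ (i) for `ℙ¹`: the spine — Vojta in degree `≤ d` from a menu of
# mechanisms with EXACT avoidance

S. Mochizuki, *Arithmetic elliptic curves in general position*, Math. J. Okayama Univ. 52 (2010)
[cite: MochizukiGenEll2010, Thm 2.1 p.12], proof of Thm. 2.1, p. 12: a noncritical Belyi map is
chosen for each limit configuration of conjugates, and compactness ("the compactness of the set of
rational points of `X` over any finite extension of `ℚ_v`") reduces to finitely many. The tree's
`exists_finset_cover_of_degree_le` / `vojtaIneq_univ_of_cover` (`GenEllConjugateCompactness`, w5-d081)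
IS that compactness step, for mechanisms given by OPEN conditions on the conjugates at `∞` and at `p`.

This file is the SPINE of the `GenEllTwo` assembly (abc-iut cell, GENELLTWO-P1ROUTE W9): it converts a
menu of mechanisms `m : M`, each available at every radius `r > 0` with

* open, antitone-in-`r` condition sets `U m r ⊆ ℂ`, `V m r ⊆ Q̄_2`, open at `∞`
  (`{z : γ_m(z) is r-far from X_φ}` in the application),
* a POINTWISE EXACT-AVOIDANCE predicate (`γ_m(z) ∉ X_φ`) implying membership in `U m r` for SOME
  `r > 0`, and
* Vojta's inequality in degree `≤ d`, for every `ε > 0`, on the points all of whose conjugates lie in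
  `U m r` resp. `V m r` (the transfer + noncritical-Belyi mechanism of pp. 12–13),

together with the EXACT covering hypothesis "every configuration of `≤ d` points of `ℂ ∪ {∞}` and
`≤ d` points of `Q̄_2 ∪ {∞}` is avoided by some mechanism" (the finite-menu lemma), into
`VojtaP1Deg d` ([GenEll] Thm. 2.1 (i) for `ℙ¹`): `vojtaP1Deg_of_menu`. The radii are chosen AFTER the
mechanism (minimum over the finitely many entries of the configuration), and finiteness of the
subcover is `GenEllConjugateCompactness`. Theorems only; no definitions, no named facts.
-/

noncomputable section

open NumberField

namespace Literature.NumberTheory.DiophantineGeometry.GenEll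

/-- A finite family of positive reals indexed by `Fin d` (with a default) has a positive lower bound
below all of them. [folklore] -/
private theorem exists_pos_le_all {d : ℕ} (ρ : Fin d → ℝ) (hρ : ∀ j, 0 < ρ j) :
    ∃ r : ℝ, 0 < r ∧ ∀ j, r ≤ ρ j := by
  classical
  by_cases hd : d = 0
  · subst hd; exact ⟨1, one_pos, fun j => Fin.elim0 j⟩
  · haveI : Nonempty (Fin d) := ⟨⟨0, Nat.pos_of_ne_zero hd⟩⟩
    obtain ⟨j₀, -, hj₀⟩ := Finset.exists_min_image Finset.univ ρ Finset.univ_nonempty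
    exact ⟨ρ j₀, hρ j₀, fun j => hj₀ j (Finset.mem_univ j)⟩

/-- **The spine: [GenEll] Thm. 2.1 (i) for `ℙ¹` in degree `≤ d` from a menu of mechanisms with exact
avoidance** (prime `2`, the support `Σ = {2}` of `GenEllTwo`). Data: mechanisms `m : M`; for each
`m` and radius `r`, condition sets `U m r ⊆ ℂ` and `V m r ⊆ Q̄_2`, open, antitone in `r`, each
containing a neighbourhood of `∞`; pointwise avoidance predicates `A m : ℂ → Prop`,
`B m : Q̄_2 → Prop` with `A m z → ∃ r > 0, z ∈ U m r` (and the same for `B`, `V`). Hypotheses: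
(mechanisms) for every `m`, `r > 0`, `ε > 0`, Vojta's inequality holds in degree `≤ d` on the points
all of whose conjugates lie in `U m r` (at `∞`) and in `V m r` (at `2`); (exact cover) every
configuration of `d` points of `ℂ ∪ {∞}` and `d` points of `Q̄_2 ∪ {∞}` is avoided, entry by entry
(`∞` always admissible), by some mechanism. Conclusion: `VojtaP1Deg d`.
[cite: MochizukiGenEll2010, Thm 2.1 p.12] -/
theorem vojtaP1Deg_of_menu (d : ℕ) {M : Type*}
    (U : M → ℝ → Set ℂ) (V : M → ℝ → Set (PadicAlgCl 2))
    (hUopen : ∀ m r, IsOpen (U m r)) (hVopen : ∀ m r, IsOpen (V m r))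
    (hUinf : ∀ m r, 0 < r → ∃ R : ℝ, ∀ z : ℂ, R < ‖z‖ → z ∈ U m r)
    (hVinf : ∀ m r, 0 < r → ∃ R : ℝ, ∀ z : PadicAlgCl 2, R < ‖z‖ → z ∈ V m r)
    (hUmono : ∀ m {r r' : ℝ}, r ≤ r' → U m r' ⊆ U m r)
    (hVmono : ∀ m {r r' : ℝ}, r ≤ r' → V m r' ⊆ V m r)
    (A : M → ℂ → Prop) (B : M → PadicAlgCl 2 → Prop)
    (hA : ∀ m z, A m z → ∃ r : ℝ, 0 < r ∧ z ∈ U m r)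
    (hB : ∀ m y, B m y → ∃ r : ℝ, 0 < r ∧ y ∈ V m r)
    (hmech : ∀ m (r : ℝ), 0 < r → ∀ ε : ℝ, 0 < ε →
      VojtaIneq {P : NFPoint | (∀ σ : P.F →+* ℂ, σ P.x ∈ U m r) ∧
        (∀ σ : P.F →+* PadicAlgCl 2, σ P.x ∈ V m r)} d ε)
    (hcover : ∀ (a : Fin d → OnePoint ℂ) (b : Fin d → OnePoint (PadicAlgCl 2)), ∃ m : M,
      (∀ j, a j = OnePoint.infty ∨ ∃ z : ℂ, a j = ↑z ∧ A m z) ∧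
        (∀ j, b j = OnePoint.infty ∨ ∃ y : PadicAlgCl 2, b j = ↑y ∧ B m y)) :
    VojtaP1Deg d := by
  classical
  haveI : Fact (Nat.Prime 2) := ⟨Nat.prime_two⟩
  intro ε hε
  -- mechanisms indexed by (m, r) with r > 0, all open at ∞
  let ι := M × {r : ℝ // 0 < r}
  refine vojtaIneq_univ_of_cover 2 d (ι := ι) (fun i => U i.1 i.2.1) (fun i => hUopen i.1 i.2.1)
    (fun i => V i.1 i.2.1) (fun i => hVopen i.1 i.2.1) Set.univ Set.univ
    (fun i _ => hUinf i.1 i.2.1 i.2.2) (fun i _ => hVinf i.1 i.2.1 i.2.2) ?_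
    (fun i => hmech i.1 i.2.1 i.2.2 ε hε)
  intro a b
  obtain ⟨m, ha, hb⟩ := hcover a b
  -- a positive radius for each entry (1 for the entries `∞`)
  have hra : ∀ j, ∃ ρ : ℝ, 0 < ρ ∧ ∀ z : ℂ, a j = ↑z → z ∈ U m ρ := by
    intro j
    rcases ha j with h | ⟨z, hz, hAz⟩
    · exact ⟨1, one_pos, fun z hz => by rw [h] at hz; exact absurd hz (OnePoint.infty_ne_coe z)⟩
    · obtain ⟨ρ, hρ, hzU⟩ := hA m z hAz
      refine ⟨ρ, hρ, fun z' hz' => ?_⟩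
      rw [hz] at hz'
      rw [← OnePoint.coe_injective hz']
      exact hzU
  have hrb : ∀ j, ∃ ρ : ℝ, 0 < ρ ∧ ∀ y : PadicAlgCl 2, b j = ↑y → y ∈ V m ρ := by
    intro j
    rcases hb j with h | ⟨y, hy, hBy⟩
    · exact ⟨1, one_pos, fun y hy => by rw [h] at hy; exact absurd hy (OnePoint.infty_ne_coe y)⟩
    · obtain ⟨ρ, hρ, hyV⟩ := hB m y hBy
      refine ⟨ρ, hρ, fun y' hy' => ?_⟩
      rw [hy] at hy'
      rw [← OnePoint.coe_injective hy']
      exact hyV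
  choose ρa hρa hUa using hra
  choose ρb hρb hVb using hrb
  obtain ⟨r₁, hr₁, hr₁le⟩ := exists_pos_le_all ρa hρa
  obtain ⟨r₂, hr₂, hr₂le⟩ := exists_pos_le_all ρb hρb
  refine ⟨⟨m, ⟨min r₁ r₂, lt_min hr₁ hr₂⟩⟩, fun j => ?_, fun j => ?_⟩
  · rcases ha j with h | ⟨z, hz, -⟩
    · exact Or.inr ⟨h, Set.mem_univ _⟩
    · refine Or.inl ⟨z, ?_, hz⟩
      exact hUmono m ((min_le_left _ _).trans (hr₁le j)) (hUa j z hz)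
  · rcases hb j with h | ⟨y, hy, -⟩
    · exact Or.inr ⟨h, Set.mem_univ _⟩
    · refine Or.inl ⟨y, ?_, hy⟩
      exact hVmono m ((min_le_right _ _).trans (hr₂le j)) (hVb j y hy)

end Literature.NumberTheory.DiophantineGeometry.GenEll

end
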